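import Summits.QuantumFields.YangMills.Theorems.ChatterjeeMassGapTorusAxialBoxRigidityKeys
import HarnessLib

/-!
# S28ᵀ (Chatterjee torus-axial mass gap) — support rigidity of the box `∂B`
(ym-idea-4 g6, LINE-17, part II: the theorem)

Bears on rung S28ᵀ through obligation (O1) of the fork
`S28BoxBit.gapCore_eventually_of_boxCumulant` (LINE-10).  The eighth strong-coupling Taylor
coefficient of the truncated correlation of `Q = (0;1,2)` and `P = (e₀;0,1)` is a sum of joint
cumulants of families `(Q, P, p₁, …, p₈)` of plaquette variables; such a cumulant vanishes as
soon as a member owns a link met by no OTHER member (free-link averaging, `S28FreeLink`, any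
compact `G`).  What survives is governed by the combinatorial theorem of this file,
**`eq_box_of_twoCovered`**: a set of at most ten genuine plaquettes of `ℤ⁴` containing `Q` and
`P`, every link of every member lying on a second member, IS the set of the ten faces of
`B = [0,2] × [0,1]² × {0}` (in the literal form of `S28BoxBit`).  So no family with fewer than
eight extra plaquettes survives, and at order eight exactly the `8!` orderings of the other
faces do — the combinatorial content of `p_Λ⁽⁸⁾(0) = 8! · κ_□`, for every gauge group.

Proof ("levels"): the four links of `Q` need four distinct second plaquettes (`Q`-neighbours);
the temporal links of `P` and one further temporal link force four distinct temporal plaquettes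
between times `1` and `2`; a second plaquette through any of their top links has base time `2`,
so it is none of the nine found and, `S` having at most ten members, one plaquette carries all
four top links; the base links (time `1`) are then carried by `Q`-neighbours, which happens only
for the square above `Q`.  All finite incidence checks are delegated to the kernel through the
list `T e` of genuine plaquettes through a link (`mem_through`); an independent exhaustive
search (4741 nodes) confirms the statement.  No summit is proved here.
-/


open Finset
open Literature.MathematicalPhysics.QuantumFieldTheory (Plaq Plaq.bonds)
open Literature.MathematicalPhysics.QuantumLattice (ZdEdge)
open Literature.Probability.LatticeModels (Site)

namespace Summit.QuantumFields.YangMills.Theorems.S28BoxRigidity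

/-- **Support rigidity of the box `∂B`.** A set `S` of at most ten genuine plaquettes of `ℤ⁴`
that contains `Q = (0;1,2)` and `P = (e₀;0,1)` and in which every link of every member lies on
a second member is the set of the ten faces of `B = [0,2] × [0,1]² × {0}`, listed as in
`S28BoxBit`.  (For every gauge group this is what selects, among the joint cumulants
`κ(Q, P, p₁, …, p₈)` making up `p_Λ⁽⁸⁾(0)`, exactly the `8!` orderings of the other eight
faces; fewer than eight extra plaquettes never survive.) [folklore] -/
theorem eq_box_of_twoCovered (S : Finset (Plaq 4)) (hgen : ∀ q ∈ S, q.2.1 < q.2.2)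
    (hQ : (((0 : Site 4), 1, 2) : Plaq 4) ∈ S)
    (hP : (((Pi.single 0 1 : Site 4), 0, 1) : Plaq 4) ∈ S) (hcard : S.card ≤ 10)
    (h2 : ∀ q ∈ S, ∀ e ∈ Plaq.bonds q, ∃ q' ∈ S, q' ≠ q ∧ e ∈ Plaq.bonds q') :
    S =
      ({((0 : Site 4), 1, 2), ((Pi.single 0 2 : Site 4), 1, 2), ((0 : Site 4), 0, 1), ((Pi.single
      2 1 : Site 4), 0, 1), ((0 : Site 4), 0, 2), ((Pi.single 1 1 : Site 4), 0, 2), ((Pi.single 0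
      1 : Site 4), 0, 1), ((Pi.single 0 1 + Pi.single 2 1 : Site 4), 0, 1), ((Pi.single 0 1 : Site
      4), 0, 2), ((Pi.single 0 1 + Pi.single 1 1 : Site 4), 0, 2)} : Finset (Plaq 4)) := by
  obtain ⟨T, hT⟩ : ∃ T : ZdEdge 4 → Finset (Plaq 4), T = fun e =>
      ((((Finset.univ : Finset (Fin 4 × Fin 4)).filter fun ij => ij.1 < ij.2).biUnion fun ij =>
      ({(e.1, ij.1, ij.2), (e.1 - Pi.single ij.1 1, ij.1, ij.2), (e.1 - Pi.single ij.2 1, ij.1,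
      ij.2)} : Finset (Plaq 4))).filter fun q => e ∈ Plaq.bonds q) :=
    ⟨_, rfl⟩
  have hTm : ∀ {q : Plaq 4}, q ∈ S → ∀ {e : ZdEdge 4}, e ∈ Plaq.bonds q → q ∈ T e :=
    fun hq _ he => mem_through T hT (hgen _ hq) he
  obtain ⟨K0, K1, hE0, hE1, hE2, hE3, hV1, hV2, hTP⟩ := keysQ T hT
  obtain ⟨K3, K3b, K3c, K4⟩ := keysP T hT
  obtain ⟨K5a, K5b, K5c, K5d, hNl, hPl⟩ := keysTop T hT
  obtain ⟨K7, K8⟩ := keysBase T hT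
  obtain ⟨K9, K10⟩ := keysBox
  -- second plaquettes through the four links of `Q`
  obtain ⟨c0, hc0S, hc0ne, hc0e⟩ := h2 _ hQ _ hE0
  obtain ⟨c1, hc1S, hc1ne, hc1e⟩ := h2 _ hQ _ hE1
  obtain ⟨c2, hc2S, hc2ne, hc2e⟩ := h2 _ hQ _ hE2
  obtain ⟨c3, hc3S, hc3ne, hc3e⟩ := h2 _ hQ _ hE3
  have hc0N := K0 _ hE0 _ (hTm hc0S hc0e) hc0ne
  have hc1N := K0 _ hE1 _ (hTm hc1S hc1e) hc1ne
  have hc2N := K0 _ hE2 _ (hTm hc2S hc2e) hc2ne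
  have hc3N := K0 _ hE3 _ (hTm hc3S hc3e) hc3ne
  have hCcard := K1 _ (hTm hc0S hc0e) hc0ne _ (hTm hc1S hc1e) hc1ne _ (hTm hc2S hc2e) hc2ne
    _ (hTm hc3S hc3e) hc3ne
  -- temporal plaquettes between times 1 and 2
  obtain ⟨q1, hq1S, hq1ne, hq1e⟩ := h2 _ hP _ hV1
  obtain ⟨q2, hq2S, hq2ne, hq2e⟩ := h2 _ hP _ hV2
  have hq1T := hTm hq1S hq1e
  have hq2T := hTm hq2S hq2e
  obtain ⟨hq1z, hq1top⟩ := K3 _ hq1T hq1ne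
  obtain ⟨q3, hq3S, hq3ne, hq3e⟩ := h2 _ hq1S _ hq1z
  have hq3T := hTm hq3S hq3e
  obtain ⟨hEcard, hEdisj⟩ := K4 _ hq1T hq1ne _ hq2T hq2ne _ hq3T hq3ne
  -- second plaquettes through the four top links
  obtain ⟨r0, hr0S, hr0ne, hr0e⟩ := h2 _ hP _ hTP
  obtain ⟨r1, hr1S, hr1ne, hr1e⟩ := h2 _ hq1S _ hq1top
  obtain ⟨r2, hr2S, hr2ne, hr2e⟩ := h2 _ hq2S _ (K3b _ hq2T hq2ne)
  obtain ⟨r3, hr3S, hr3ne, hr3e⟩ := h2 _ hq3S _ (K3c _ hq1T hq1ne _ hq3T hq3ne)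
  have hr0l := K5a _ (hTm hr0S hr0e) hr0ne
  obtain ⟨hq1l, hr1l⟩ := K5b _ hq1T hq1ne
  obtain ⟨hq2l, hr2l⟩ := K5c _ hq2T hq2ne
  obtain ⟨hq3l, hr3l⟩ := K5d _ hq1T hq1ne _ hq3T hq3ne
  replace hr1l := hr1l _ (hTm hr1S hr1e) hr1ne
  replace hr2l := hr2l _ (hTm hr2S hr2e) hr2ne
  replace hr3l := hr3l _ (hTm hr3S hr3e) hr3ne
  -- the nine plaquettes found so far
  set C : Finset (Plaq 4) := {(((0 : Site 4), 1, 2) : Plaq 4), c0, c1, c2, c3} with hC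
  set E : Finset (Plaq 4) := {(((Pi.single 0 1 : Site 4), 0, 1) : Plaq 4), q1, q2, q3} with hE
  have hCsub : C ⊆ insert (((0 : Site 4), 1, 2) : Plaq 4)
        ({((![0, 0, 0, 0] : Site 4), 0, 1), ((![-1, 0, 0, 0] : Site 4), 0, 1), ((![0, 0, -1, 0] :
        Site 4), 1, 2), ((![0, 0, 0, 0] : Site 4), 1, 3), ((![0, 0, 0, -1] : Site 4), 1, 3),
        ((![0, 1, 0, 0] : Site 4), 0, 2), ((![-1, 1, 0, 0] : Site 4), 0, 2), ((![0, 1, 0, 0] :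
        Site 4), 1, 2), ((![0, 1, 0, 0] : Site 4), 2, 3), ((![0, 1, 0, -1] : Site 4), 2, 3),
        ((![0, 0, 1, 0] : Site 4), 0, 1), ((![-1, 0, 1, 0] : Site 4), 0, 1), ((![0, 0, 1, 0] :
        Site 4), 1, 2), ((![0, 0, 1, 0] : Site 4), 1, 3), ((![0, 0, 1, -1] : Site 4), 1, 3),
        ((![0, 0, 0, 0] : Site 4), 0, 2), ((![-1, 0, 0, 0] : Site 4), 0, 2), ((![0, -1, 0, 0] :
        Site 4), 1, 2), ((![0, 0, 0, 0] : Site 4), 2, 3), ((![0, 0, 0, -1] : Site 4), 2, 3)} :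
        Finset (Plaq 4)) := by
    intro x hx
    simp only [hC, Finset.mem_insert, Finset.mem_singleton] at hx
    rcases hx with rfl | rfl | rfl | rfl | rfl
    · exact Finset.mem_insert_self _ _
    · exact Finset.mem_insert_of_mem hc0N
    · exact Finset.mem_insert_of_mem hc1N
    · exact Finset.mem_insert_of_mem hc2N
    · exact Finset.mem_insert_of_mem hc3N
  have hAcard : (C ∪ E).card = 9 := by
    rw [Finset.card_union_of_disjoint (Finset.disjoint_of_subset_left hCsub hEdisj), hCcard, hEcard]
  have hAS : C ∪ E ⊆ S := by
    intro x hx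
    rcases Finset.mem_union.1 hx with hx | hx
    · simp only [hC, Finset.mem_insert, Finset.mem_singleton] at hx
      rcases hx with rfl | rfl | rfl | rfl | rfl <;> assumption
    · simp only [hE, Finset.mem_insert, Finset.mem_singleton] at hx
      rcases hx with rfl | rfl | rfl | rfl <;> assumption
  have hAl : ∀ x ∈ C ∪ E, x.1 0 ≠ 2 := by
    intro x hx
    rcases Finset.mem_union.1 hx with hx | hx
    · exact hNl _ (hCsub hx)
    · simp only [hE, Finset.mem_insert, Finset.mem_singleton] at hx
      rcases hx with rfl | rfl | rfl | rfl
      · rw [hPl]; decide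
      · rw [hq1l]; decide
      · rw [hq2l]; decide
      · rw [hq3l]; decide
  -- the tenth plaquette carries all four top links
  have hsd : (S \ (C ∪ E)).card ≤ 1 := by
    have := Finset.card_sdiff_add_card_eq_card hAS
    omega
  have hrm : ∀ {r : Plaq 4}, r ∈ S → r.1 0 = 2 → r ∈ S \ (C ∪ E) :=
    fun hrS hrl => Finset.mem_sdiff.2 ⟨hrS, fun h => hAl _ h hrl⟩
  have hr10 : r1 = r0 := Finset.card_le_one.1 hsd _ (hrm hr1S hr1l) _ (hrm hr0S hr0l)
  have hr20 : r2 = r0 := Finset.card_le_one.1 hsd _ (hrm hr2S hr2l) _ (hrm hr0S hr0l)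
  have hr30 : r3 = r0 := Finset.card_le_one.1 hsd _ (hrm hr3S hr3l) _ (hrm hr0S hr0l)
  rw [hr10] at hr1e
  rw [hr20] at hr2e
  rw [hr30] at hr3e
  have hr0T := hTm hr0S hr0e
  have hS10 : S = insert r0 (C ∪ E) := by
    refine (Finset.eq_of_subset_of_card_le (Finset.insert_subset_iff.2 ⟨hr0S, hAS⟩) ?_).symm
    rw [Finset.card_insert_of_notMem (fun h => hAl _ h hr0l), hAcard]
    exact hcard
  -- base links: carried by `Q`-neighbours
  have hbase : ∀ x ∈ E, ∃ c ∈
        ({((![0, 0, 0, 0] : Site 4), 0, 1), ((![-1, 0, 0, 0] : Site 4), 0, 1), ((![0, 0, -1, 0] :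
        Site 4), 1, 2), ((![0, 0, 0, 0] : Site 4), 1, 3), ((![0, 0, 0, -1] : Site 4), 1, 3),
        ((![0, 1, 0, 0] : Site 4), 0, 2), ((![-1, 1, 0, 0] : Site 4), 0, 2), ((![0, 1, 0, 0] :
        Site 4), 1, 2), ((![0, 1, 0, 0] : Site 4), 2, 3), ((![0, 1, 0, -1] : Site 4), 2, 3),
        ((![0, 0, 1, 0] : Site 4), 0, 1), ((![-1, 0, 1, 0] : Site 4), 0, 1), ((![0, 0, 1, 0] :
        Site 4), 1, 2), ((![0, 0, 1, 0] : Site 4), 1, 3), ((![0, 0, 1, -1] : Site 4), 1, 3),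
        ((![0, 0, 0, 0] : Site 4), 0, 2), ((![-1, 0, 0, 0] : Site 4), 0, 2), ((![0, -1, 0, 0] :
        Site 4), 1, 2), ((![0, 0, 0, 0] : Site 4), 2, 3), ((![0, 0, 0, -1] : Site 4), 2, 3)} :
        Finset (Plaq 4)),
      c ∈ S ∧ (((x.1 : Site 4), x.2.2) : ZdEdge 4) ∈ Plaq.bonds c := by
    intro x hx
    obtain ⟨hbx, hbQ, hbr, hby⟩ :=
      K7 _ hr0T hr0ne _ hq1T hq1ne hr1e _ hq2T hq2ne hr2e _ hq3T hq3ne hr3e x hx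
    obtain ⟨s, hsS, hsne, hse⟩ := h2 _ (hAS (Finset.mem_union_right _ hx)) _ hbx
    have hsS' := hsS
    rw [hS10] at hsS'
    rcases Finset.mem_insert.1 hsS' with rfl | hs'
    · exact absurd hse hbr
    rcases Finset.mem_union.1 hs' with hsC | hsE
    · simp only [hC, Finset.mem_insert, Finset.mem_singleton] at hsC
      rcases hsC with rfl | rfl | rfl | rfl | rfl
      · exact absurd hse hbQ
      · exact ⟨_, hc0N, hc0S, hse⟩
      · exact ⟨_, hc1N, hc1S, hse⟩
      · exact ⟨_, hc2N, hc2S, hse⟩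
      · exact ⟨_, hc3N, hc3S, hse⟩
    · by_cases hsx : s = x
      · exact absurd hsx hsne
      · exact absurd hse (hby s hsE hsx)
  obtain ⟨rfl, rfl, rfl, rfl⟩ := K8 _ hr0T hr0ne _ hq1T hq1ne hr1e _ hq2T hq2ne hr2e _ hq3T hq3ne
    hr3e fun x hx => (hbase x hx).imp fun c hc => ⟨hc.1, hc.2.2⟩
  -- the four `Q`-neighbours are the temporal plaquettes above the links of `Q`
  obtain ⟨t0, ht0N, ht0S, ht0e⟩ := hbase (((Pi.single 0 1 : Site 4), 0, 1) : Plaq 4) (by simp [hE])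
  obtain ⟨t1, ht1N, ht1S, ht1e⟩ := hbase (((Pi.single 0 1 : Site 4), 0, 2) : Plaq 4) (by simp [hE])
  obtain ⟨t2, ht2N, ht2S, ht2e⟩ := hbase (((Pi.single 0 1 + Pi.single 1 1 : Site 4), 0,
      2) : Plaq 4) (by simp [hE])
  obtain ⟨t3, ht3N, ht3S, ht3e⟩ := hbase (((Pi.single 0 1 + Pi.single 2 1 : Site 4), 0,
      1) : Plaq 4) (by simp [hE])
  obtain rfl := (K9 _ ht0N).1 ht0e
  obtain rfl := (K9 _ ht1N).2.1 ht1e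
  obtain rfl := (K9 _ ht2N).2.2.1 ht2e
  obtain rfl := (K9 _ ht3N).2.2.2 ht3e
  -- all ten faces lie in `S`, and `S` has at most ten elements
  refine (Finset.eq_of_subset_of_card_le (fun b hb => ?_) (K10.symm ▸ hcard)).symm
  simp only [Finset.mem_insert, Finset.mem_singleton] at hb
  rcases hb with rfl | rfl | rfl | rfl | rfl | rfl | rfl | rfl | rfl | rfl <;> assumption

end Summit.QuantumFields.YangMills.Theorems.S28BoxRigidity
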